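import Summits.QuantumFields.YangMills.Theorems.SwapVirialDeficitVirialWindowOfPrincipalAndMinus
import Summits.QuantumFields.YangMills.Theorems.SwapVirialDeficitBlowUpPrincipalStiffnessOfLeaders
import HarnessLib

/-!
# ⟨24197⟩ `SwapGluedStiffness` BY NAME from the LEADERS' VALLEY INEQUALITY and the MINUS-CLASS SMALLNESS (file D4, last link of the V2′ reduction chain;
# free-hands support of ⟨stmt-QuantumFields-24197⟩ `SwapVirialDeficit.SwapGluedStiffness`)

Composition of w2 g57's ✓`principalStiffness_of_leadersWindow` (the followers' share of `½⟪gnoW⟫` absorbed, uniformly in `L`) with ✓`virialTerm_eq` and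
✓`swapGluedStiffness_of_principalVirialWindow_and_minus` (D3: odd sectors and pairings discharged):
* `principalVirialWindow_of_leadersWindow` — (P-VW) of D3 from the LEADERS' WINDOW INEQUALITY (LW):
  `∃ a > 0, c > 0, β₀, L₀`: on the window `K_L·(½⟪W_L⟫_{000,β} − β⟪R⟫_{000,β}) ≤ (1/2 − c)·Z_{000}(β)`, `W_L = gnoWtr(x) + gnoWtr(y) + gnomonicW(z)`;
* ★★★ `swapGluedStiffness_of_leadersValley_and_minus (hLW) (hM) : Theses.SwapVirialDeficit.SwapGluedStiffness`.
So the crux ⟨24197⟩ is, BY NAME, [(LW) = the VALLEY TERM of the three leader letters and the third-order remainder `R = F̂ − ½XF̂` in the principal sector — a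
window-uniform two-scale estimate of a fixed finite-dimensional integral with `poly(L)` stiffness constants] + [(M) `L⁴·Z_{001} ≤ ε·Z_{000}` on a window (or
w2's (TS₀₀₁) via ✓`swapGluedStiffness_of_twoSectorStiffness`)]; everything else (virial identity, log-derivative, followers' weight, large field, odd sectors,
sector pairing) is in the tree uniformly in `L`.
HONEST LABEL: a CONDITIONAL reduction; (LW), (M), ⟨24197⟩ ∕ ⟨24194⟩ ∕ ⟨24196⟩ ∕ ⟨24497⟩ OPEN; the Yang–Mills mass gap is NOT proved; no summit is proved by a line.
Seat ym-line-fcl-p3 g46 (cell ym-idea-1, free hands; item of record ⟨24085⟩ aside, untouched), `--supports stmt-QuantumFields-24197`.  THEOREMS ONLY (hypotheses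
inline), 0 `sorry`, standard axioms; the series' local `ℍ` instances.  References: [cite: tHooft1979]; [cite: Luscher1983, §2]; [folklore].
-/

set_option autoImplicit false
set_option synthInstance.maxSize 1024

noncomputable section

open MeasureTheory Quaternion Set Filter Topology
open scoped Quaternion BigOperators
open Literature.MathematicalPhysics.QuantumLattice
open Literature.MathematicalPhysics.QuantumFieldTheory hiding SU2
open Summit.QuantumFields.YangMills.Theorems.FemtoTransferGap
open Summit.QuantumFields.YangMills.Theorems.FemtoTransferGap.TT
open Summit.QuantumFields.YangMills.Theorems.VirialFluxGap.RingDeficit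
open Summit.QuantumFields.YangMills.Theorems.SwapTwistDeficit.ToronLog (coneMeasure coneConst isProbabilityMeasure_coneMeasure)
open Summit.QuantumFields.YangMills.Theorems.SwapVirialDeficit.SwapRing
open Summit.QuantumFields.YangMills.Theorems.SwapVirialDeficit.Gnomonic (gnomonicW)

attribute [local instance] Literature.Analysis.FluidPDE.Tao2016.quatMeasurableSpace
  Literature.Analysis.FluidPDE.Tao2016.quatBorelSpace
  Literature.MathematicalPhysics.QuantumLattice.secondCountableTopology_su2

namespace Summit.QuantumFields.YangMills.Theorems.SwapVirialDeficit.BlowUpRing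

/-- ★ **(P-VW) from the leaders' window inequality (LW)**: w2 g57's ✓`principalStiffness_of_leadersWindow` (`(9L⁴ − 3/2 + c')·Z₀ ≤ β·E₀` on a window) read
back through ✓`virialTerm_eq` (`K_L·(½⟪gnoW⟫₀ − β⟪R⟫₀) = (9L⁴−1)·Z₀ − β·E₀`). [folklore] -/
theorem principalVirialWindow_of_leadersWindow
    (hLW : ∃ a : ℝ, 0 < a ∧ ∃ c : ℝ, 0 < c ∧ ∃ β₀ : ℝ, ∃ L₀ : ℕ, ∀ β : ℝ, β₀ ≤ β → ∀ (L : ℕ) [NeZero L], L₀ ≤ L → (L : ℝ) ≤ β ^ a →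
      (coneConst ^ 3 / 64 * (1 / (2 * Real.pi ^ 2)) ^ Fintype.card (Fol L)) *
          (1 / 2 * (∫ a, (∑ ε : GnoSign L, ∫ η : GnoCoord L,
              (gnoWtr η.1.1 + gnoWtr η.1.2 + gnomonicW η.2.1) * Real.exp (-(β * gnoDeficit (fun _ => false) (fun _ => 1) a ε η)) * gnoDensity η) ∂coneMeasure)
            - β * (∫ a, (∑ ε : GnoSign L, ∫ η : GnoCoord L,
              (gnoDeficit (fun _ => false) (fun _ => 1) a ε η - gnoXDeficit (fun _ => false) (fun _ => 1) a ε η / 2) *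
                Real.exp (-(β * gnoDeficit (fun _ => false) (fun _ => 1) a ε η)) * gnoDensity η) ∂coneMeasure)) ≤
        (1 / 2 - c) * ∫ p, Real.exp (-(β * swapRingDeficit L (fun _ => false) p)) ∂(ringMeasure L)) :
    ∃ a : ℝ, 0 < a ∧ ∃ c : ℝ, 0 < c ∧ ∃ β₀ : ℝ, ∃ L₀ : ℕ, ∀ β : ℝ, β₀ ≤ β → ∀ (L : ℕ) [NeZero L], L₀ ≤ L → (L : ℝ) ≤ β ^ a →
      (coneConst ^ 3 / 64 * (1 / (2 * Real.pi ^ 2)) ^ Fintype.card (Fol L)) *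
          (1 / 2 * (∫ a, (∑ ε : GnoSign L, ∫ η : GnoCoord L,
              gnoW η * Real.exp (-(β * gnoDeficit (fun _ => false) (fun _ => 1) a ε η)) * gnoDensity η) ∂coneMeasure)
            - β * (∫ a, (∑ ε : GnoSign L, ∫ η : GnoCoord L,
              (gnoDeficit (fun _ => false) (fun _ => 1) a ε η - gnoXDeficit (fun _ => false) (fun _ => 1) a ε η / 2) *
                Real.exp (-(β * gnoDeficit (fun _ => false) (fun _ => 1) a ε η)) * gnoDensity η) ∂coneMeasure)) ≤
        (1 / 2 - c) * ∫ p, Real.exp (-(β * swapRingDeficit L (fun _ => false) p)) ∂(ringMeasure L) := by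
  obtain ⟨a, ha, c, hc, β₀, L₀, h⟩ := principalStiffness_of_leadersWindow hLW
  refine ⟨a, ha, c, hc, max β₀ 1, L₀, fun β hβ L _ hL hLβ => ?_⟩
  have hβ₀ : β₀ ≤ β := (le_max_left _ _).trans hβ
  have hβpos : 0 < β := lt_of_lt_of_le one_pos ((le_max_right _ _).trans hβ)
  have hS := h β hβ₀ L hL hLβ
  rw [virialTerm_eq (fun _ => false) hβpos]
  linarith

/-- ★★★ **⟨24197⟩ BY NAME FROM THE LEADERS' VALLEY INEQUALITY AND THE MINUS-CLASS SMALLNESS**: (LW) + (M) ⟹ `Theses.SwapVirialDeficit.SwapGluedStiffness`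
(✓`principalVirialWindow_of_leadersWindow` ✓`swapGluedStiffness_of_principalVirialWindow_and_minus`).  CONDITIONAL: (LW) — the window-uniform two-scale
estimate of the three leader letters' Euler weight and of the remainder `R` in the principal sector — and (M) are OPEN. [cite: tHooft1979] [cite: Luscher1983, §2] -/
theorem swapGluedStiffness_of_leadersValley_and_minus
    (hLW : ∃ a : ℝ, 0 < a ∧ ∃ c : ℝ, 0 < c ∧ ∃ β₀ : ℝ, ∃ L₀ : ℕ, ∀ β : ℝ, β₀ ≤ β → ∀ (L : ℕ) [NeZero L], L₀ ≤ L → (L : ℝ) ≤ β ^ a →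
      (coneConst ^ 3 / 64 * (1 / (2 * Real.pi ^ 2)) ^ Fintype.card (Fol L)) *
          (1 / 2 * (∫ a, (∑ ε : GnoSign L, ∫ η : GnoCoord L,
              (gnoWtr η.1.1 + gnoWtr η.1.2 + gnomonicW η.2.1) * Real.exp (-(β * gnoDeficit (fun _ => false) (fun _ => 1) a ε η)) * gnoDensity η) ∂coneMeasure)
            - β * (∫ a, (∑ ε : GnoSign L, ∫ η : GnoCoord L,
              (gnoDeficit (fun _ => false) (fun _ => 1) a ε η - gnoXDeficit (fun _ => false) (fun _ => 1) a ε η / 2) *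
                Real.exp (-(β * gnoDeficit (fun _ => false) (fun _ => 1) a ε η)) * gnoDensity η) ∂coneMeasure)) ≤
        (1 / 2 - c) * ∫ p, Real.exp (-(β * swapRingDeficit L (fun _ => false) p)) ∂(ringMeasure L))
    (hM : ∀ ε : ℝ, 0 < ε → ∃ a : ℝ, 0 < a ∧ ∃ β₀ : ℝ, ∃ L₀ : ℕ, ∀ β : ℝ, β₀ ≤ β → ∀ (L : ℕ) [NeZero L], L₀ ≤ L → (L : ℝ) ≤ β ^ a →
      (L : ℝ) ^ 4 * ∫ p, Real.exp (-(β * swapRingDeficit L (fun k => decide (k = 2)) p)) ∂(ringMeasure L) ≤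
        ε * ∫ p, Real.exp (-(β * swapRingDeficit L (fun _ => false) p)) ∂(ringMeasure L)) :
    Summit.QuantumFields.YangMills.Theses.SwapVirialDeficit.SwapGluedStiffness :=
  swapGluedStiffness_of_principalVirialWindow_and_minus (principalVirialWindow_of_leadersWindow hLW) hM

end Summit.QuantumFields.YangMills.Theorems.SwapVirialDeficit.BlowUpRing

end
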